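import Summits.NavierStokesRegularity.NavierStokesRegularity.Theorems.StrainDoorsSaturation
import HarnessLib

/-!
# StrainDoorsSaturationGrowing — the saturation law at NON-DECREASING strain (ROUND-47 (2/3) follow-up, nsreg-p1 g34)

`Theorems/StrainDoorsSaturation.lean` (p-landed text 366526cff2ec9923) reads the saturation law (SAT) `saturation_law` for STEADY
solutions.  CLASS NOTE (honest): in the frame's zero-force finite-energy class a steady solution on `ℝ³` is trivial (Galdi's
Liouville theorem: `u ∈ L² ∩ Ḣ¹ ⊂ L^{9/2}`), so the steady corollaries are the exact DICTIONARY for the infinite-energy test solution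
(Burgers vortex, `r47/RESULTS-burgers.md`) and for quasi-steady local structures, but carry no content beyond `u = 0` inside the class.
The NON-VACUOUS form is this file: the same three conclusions under the pointwise hypothesis that the strain form is momentarily
NON-DECREASING at the critical point, `0 ≤ ⟪∂ₜ(∇u e)(t,x), e⟫` — the regime of every strain build-up, in particular of every
approach to a first blow-up along times of increasing maximal strain.
HONEST FRAME: inequalities valid for every classical solution; 0056 `NoTypeII` / NS regularity NOT touched.
-/

noncomputable section

open MeasureTheory Set Function Filter Metric Real InnerProductSpace
open _root_.Topology
open scoped ENNReal NNReal RealInnerProductSpace ContDiff Laplacian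
open Literature.Analysis Literature.Analysis.FluidPDE

set_option linter.dupNamespace false

namespace Summit.NavierStokesRegularity.NavierStokesRegularity.Theorems.StrainDoors

/-! ## §19⁺ Growing strain: (★) forces the far field to out-compress viscosity -/

/-- ★ **SATURATION AT NON-DECREASING STRAIN.**  If at a critical point `x` of the strain form the form is momentarily
NON-DECREASING in the frame's time (`0 ≤ ⟪∂ₜ(∇u e)(t,x), e⟫` — the regime of every strain build-up), then for every pair of scales
`smoothingTerm − ν·strainLap ≤ newtonNearFeed − λ²`. -/
theorem saturation_of_nondecreasing {ν T : ℝ} {u : ℝ → (EuclideanSpace ℝ (Fin 3)) → (EuclideanSpace ℝ (Fin 3))}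
    {p : ℝ → (EuclideanSpace ℝ (Fin 3)) → ℝ} (hν : 0 < ν) (hT : 0 < T)
    (hsol : IsClassicalNSSolutionOn (Ico 0 T) ν 0 u p) (hreg : ∀ T'' < T, HasBoundedSobolevNormsOn (Icc 0 T'') u)
    {t : ℝ} (ht : t ∈ Ico 0 T) {r₀ r₁ : ℝ} (hr₀ : 0 < r₀) (hr₁ : r₀ < r₁)
    {x e : EuclideanSpace ℝ (Fin 3)} (he : ‖e‖ = 1) (hcrit : fderiv ℝ (fun y => ⟪fderiv ℝ (u t) y e, e⟫) x = 0)
    (hgrow : 0 ≤ ⟪timeDerivWithin (Ico 0 T) (fun s y => fderiv ℝ (u s) y e) t x, e⟫) :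
    smoothingTerm r₀ r₁ p t x e - ν * strainLap u t x e ≤ newtonNearFeed r₀ r₁ u t x e - strainQuad u t x e ^ 2 := by
  have h := saturation_law hν hT hsol hreg ht hr₀ hr₁ he hcrit
  linarith

/-- ★ **(★) AT A GROWING MAXIMISER FORCES FAR-FIELD COMPRESSION.**  If the D8 parity `newtonNearFeed ≤ λ²` holds at an exact strain
maximiser `(x,e)` at which the strain form is non-decreasing, then there `smoothingTerm ≤ ν·strainLap ≤ 0`: the energy-class far
field must compress the top strain at least as much as viscosity diffuses the strain form. -/
theorem smoothingTerm_le_of_nondecreasing_parity {ν T : ℝ} {u : ℝ → (EuclideanSpace ℝ (Fin 3)) → (EuclideanSpace ℝ (Fin 3))}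
    {p : ℝ → (EuclideanSpace ℝ (Fin 3)) → ℝ} (hν : 0 < ν) (hT : 0 < T)
    (hsol : IsClassicalNSSolutionOn (Ico 0 T) ν 0 u p) (hreg : ∀ T'' < T, HasBoundedSobolevNormsOn (Icc 0 T'') u)
    {t : ℝ} (ht : t ∈ Ico 0 T) {r₀ r₁ : ℝ} (hr₀ : 0 < r₀) (hr₁ : r₀ < r₁)
    {x e : EuclideanSpace ℝ (Fin 3)} (hax : IsStrainArgmax u t x e)
    (hgrow : 0 ≤ ⟪timeDerivWithin (Ico 0 T) (fun s y => fderiv ℝ (u s) y e) t x, e⟫)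
    (hpar : newtonNearFeed r₀ r₁ u t x e ≤ strainQuad u t x e ^ 2) :
    smoothingTerm r₀ r₁ p t x e ≤ ν * strainLap u t x e ∧ ν * strainLap u t x e ≤ 0 := by
  have hsm : ContDiff ℝ ∞ (u t) := hsol.smooth_velocity.contDiff_slice ht
  have hloc : IsLocalMax (fun y => strainQuad u t y e) x :=
    Filter.Eventually.of_forall fun y => hax.2 y e hax.1
  have h := saturation_of_nondecreasing hν hT hsol hreg ht hr₀ hr₁ hax.1 hloc.fderiv_eq_zero hgrow
  have hlap : strainLap u t x e ≤ 0 := strainLap_nonpos_of_isStrainArgmax hsm hax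
  refine ⟨by linarith, ?_⟩
  exact mul_nonpos_iff.2 (Or.inl ⟨hν.le, hlap⟩)

/-- ★ **THE BURGERS SIDE (contrapositive).**  Where viscosity out-diffuses the far field at a critical point of a non-decreasing
strain form, `ν·strainLap < smoothingTerm` (Burgers vortex at its strain argmax, every outer scale `r₁ ≳ 5.5 r_c`:
`ν|strainLap| = α(λ_max + α/2)` while the far-field term tends to `¼α²`), the D8 parity FAILS: `λ² < newtonNearFeed`. -/
theorem not_parity_of_nondecreasing {ν T : ℝ} {u : ℝ → (EuclideanSpace ℝ (Fin 3)) → (EuclideanSpace ℝ (Fin 3))}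
    {p : ℝ → (EuclideanSpace ℝ (Fin 3)) → ℝ} (hν : 0 < ν) (hT : 0 < T)
    (hsol : IsClassicalNSSolutionOn (Ico 0 T) ν 0 u p) (hreg : ∀ T'' < T, HasBoundedSobolevNormsOn (Icc 0 T'') u)
    {t : ℝ} (ht : t ∈ Ico 0 T) {r₀ r₁ : ℝ} (hr₀ : 0 < r₀) (hr₁ : r₀ < r₁)
    {x e : EuclideanSpace ℝ (Fin 3)} (he : ‖e‖ = 1) (hcrit : fderiv ℝ (fun y => ⟪fderiv ℝ (u t) y e, e⟫) x = 0)
    (hgrow : 0 ≤ ⟪timeDerivWithin (Ico 0 T) (fun s y => fderiv ℝ (u s) y e) t x, e⟫)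
    (hvisc : ν * strainLap u t x e < smoothingTerm r₀ r₁ p t x e) :
    strainQuad u t x e ^ 2 < newtonNearFeed r₀ r₁ u t x e := by
  have h := saturation_of_nondecreasing hν hT hsol hreg ht hr₀ hr₁ he hcrit hgrow
  linarith

/-! ## Audit -/
#print axioms saturation_of_nondecreasing
#print axioms smoothingTerm_le_of_nondecreasing_parity
#print axioms not_parity_of_nondecreasing

end Summit.NavierStokesRegularity.NavierStokesRegularity.Theorems.StrainDoors

end
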